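import Summits.NavierStokesRegularity.FluidComputer.PalasekTowerGermHostPotentialAmplifier
import Literature.Analysis.FluidPDE.WholeSpaceIBP
import Literature.Analysis.FluidPDE.VorticityCalculus
import Literature.Analysis.FluidPDE.ElgindiBlowup
import Literature.Analysis.FluidPDE.ConstantinFeffermanEnstrophySlab
import Literature.Analysis.FluidPDE.NSWave0

/-!
# The germ host — truncating a Schwartz vector potential: compactly supported approximants of `curl A`

Cell `ns-blowup`, seat `ns-blowup-ecbridge-3` (g7; D-0074 GROUP C «BRIDGE SUPPORT», lineage
`host_preparation`; bears_on LADDER-NS N1, route `PalasekTowerBreakdown`, crux `EpisodeBase` = item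
stmt-NavierStokesRegularity-19179). LABEL: E–C typing (theorems only; no definition, no named fact, no
`sorry`). WHAT THIS IS NOT: not Navier–Stokes evidence — static calculus on one explicit field.

The approximable-amplifier door (`Germ.exists_compact_approximant_freeRun`) asks, for a Schwartz mechanism
datum `W`, compactly supported smooth divergence-free approximants of speed `< Y₀` at every sup distance.
For `W = curl A` with `A` a smooth Schwartz potential (`HasRapidSpatialDecay A`) and `4 sup‖DA‖ < Y₀` they are
the truncations `curl (cutoff ρ • A)` (`Literature.Analysis.FluidPDE.cutoff`: `= 1` on `‖x‖ ≤ ρ`, `= 0` off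
`‖x‖ < 2ρ`, gradient `≤ C/ρ`): `exists_compact_truncation_curl`. Also `hasRapidSpatialDecay_curl`
(`curl A` is Schwartz when `A` is). References: A. J. Majda, A. L. Bertozzi (2002) §1.1 (1.11)
[cite: MajdaBertozziCUP2002, §1.1 (1.11)]; J. Leray, Acta Math. 63 (1934) §6 (truncation by large spheres)
[cite: Leray1934, §19 (3.4)–(3.8)].
-/

noncomputable section

namespace Summit.NavierStokesRegularity.FluidComputer.PalasekTowerClayBridge.Germ

open Set Function Filter Topology Metric
open scoped Topology ContDiff
open Literature.Analysis Literature.Analysis.FluidPDE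

variable {A : EuclideanSpace ℝ (Fin 3) → EuclideanSpace ℝ (Fin 3)} {L : ℝ}

/-- `curl A` is a Schwartz field when `A` is (`‖Dⁿ curl A‖ ≤ ‖curlCLM‖ ‖Dⁿ⁺¹ A‖`).
[cite: MajdaBertozziCUP2002, §1.1 (1.11)] -/
theorem hasRapidSpatialDecay_curl (hA : ContDiff ℝ ∞ A) (hAdec : HasRapidSpatialDecay A) :
    HasRapidSpatialDecay (curl A) := by
  intro n K
  obtain ⟨C, hC⟩ := hAdec (n + 1) K
  refine ⟨‖curlCLM‖ * max C 0, fun x => ?_⟩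
  have h1 := norm_iteratedFDeriv_curl_le_opNorm_mul (N := ⊤) hA n (by exact_mod_cast le_top) x
  have hw : 0 ≤ (1 + ‖x‖) ^ K := by positivity
  calc (1 + ‖x‖) ^ K * ‖iteratedFDeriv ℝ n (curl A) x‖
      ≤ (1 + ‖x‖) ^ K * (‖curlCLM‖ * ‖iteratedFDeriv ℝ (n + 1) A x‖) :=
        mul_le_mul_of_nonneg_left h1 hw
    _ = ‖curlCLM‖ * ((1 + ‖x‖) ^ K * ‖iteratedFDeriv ℝ (n + 1) A x‖) := by ring
    _ ≤ ‖curlCLM‖ * max C 0 :=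
        mul_le_mul_of_nonneg_left ((hC x).trans (le_max_left _ _)) (ContinuousLinearMap.opNorm_nonneg curlCLM)

/-- **Compactly supported approximants of `curl A` by truncating the potential.** Let `A` be smooth and
Schwartz with `‖DA(x)‖ ≤ L` for all `x` and `4L < Y₀`. Then for every `R` and every `δ > 0` there are
`W'`, `R'` with `W'` smooth, divergence free, `tsupport W' ⊆ B̄(0, R')`, `‖W'‖ < Y₀`, `R ≤ R'` and
`‖W'(x) − curl A(x)‖ ≤ δ` for all `x` — namely `W' = curl (cutoff ρ • A)`, `R' = 2ρ`, `ρ` large.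
[cite: MajdaBertozziCUP2002, §1.1 (1.11)] -/
theorem exists_compact_truncation_curl (hA : ContDiff ℝ ∞ A) (hAdec : HasRapidSpatialDecay A)
    (hL : ∀ x, ‖fderiv ℝ A x‖ ≤ L) (h4L : 4 * L < TowerRates.wide.Y 0) (R : ℝ) {δ : ℝ} (hδ : 0 < δ) :
    ∃ (W' : EuclideanSpace ℝ (Fin 3) → EuclideanSpace ℝ (Fin 3)) (R' : ℝ),
      ContDiff ℝ ∞ W' ∧ VectorCalculus.IsDivFree W' ∧ tsupport W' ⊆ closedBall 0 R' ∧
      (∀ x, ‖W' x‖ < TowerRates.wide.Y 0) ∧ R ≤ R' ∧ ∀ x, ‖W' x - curl A x‖ ≤ δ := by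
  -- ### decay constants of `A` and `DA`, the cut-off gradient constant
  obtain ⟨Ca, hCa⟩ := hAdec 0 1
  obtain ⟨Cb, hCb⟩ := hAdec 1 1
  have hA0 : ∀ x, ‖A x‖ ≤ Ca / (1 + ‖x‖) := fun x => by
    have h := hCa x
    rw [pow_one, norm_iteratedFDeriv_zero] at h
    rw [le_div_iff₀ (by positivity)]; linarith
  have hA1 : ∀ x, ‖fderiv ℝ A x‖ ≤ Cb / (1 + ‖x‖) := fun x => by
    have h := hCb x
    rw [pow_one, ← norm_iteratedFDeriv_fderiv, norm_iteratedFDeriv_zero] at h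
    rw [le_div_iff₀ (by positivity)]; linarith
  have hCa0 : 0 ≤ Ca := by
    have := hA0 0; have h2 := norm_nonneg (A 0)
    have : (0 : ℝ) ≤ Ca / (1 + ‖(0 : EuclideanSpace ℝ (Fin 3))‖) := h2.trans this
    simpa using this
  have hCb0 : 0 ≤ Cb := by
    have := hA1 0; have h2 := norm_nonneg (fderiv ℝ A 0)
    have : (0 : ℝ) ≤ Cb / (1 + ‖(0 : EuclideanSpace ℝ (Fin 3))‖) := h2.trans this
    simpa using this
  have hAsup : ∀ x, ‖A x‖ ≤ Ca := fun x =>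
    (hA0 x).trans (div_le_self hCa0 (by linarith [norm_nonneg x]))
  have hL0 : 0 ≤ L := (norm_nonneg _).trans (hL 0)
  obtain ⟨C, hC0, hC⟩ := Literature.Analysis.FluidPDE.exists_norm_fderiv_cutoff_le (E := EuclideanSpace ℝ (Fin 3))
  -- ### the radius
  set gap : ℝ := TowerRates.wide.Y 0 / 4 - L with hgap
  have hgap0 : 0 < gap := by rw [hgap]; linarith
  set ρ : ℝ := max (max R 1) (max (2 * C * Ca / gap + 1) (8 * (Cb + C * Ca) / δ + 1)) with hρ_def
  have hρ1 : 1 ≤ ρ := (le_max_right _ _).trans (le_max_left _ _)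
  have hρ0 : 0 < ρ := by linarith
  have hρR : R ≤ ρ := (le_max_left _ _).trans (le_max_left _ _)
  have hρgap : 2 * C * Ca / gap + 1 ≤ ρ := (le_max_left _ _).trans (le_max_right _ _)
  have hρδ : 8 * (Cb + C * Ca) / δ + 1 ≤ ρ := (le_max_right _ _).trans (le_max_right _ _)
  -- `C Ca / ρ ≤ gap / 2` and `4 (Cb + C Ca) / ρ ≤ δ / 2`
  have hspeed_aux : C * Ca / ρ < gap := by
    rw [div_lt_iff₀ hρ0]
    have h1 : 2 * C * Ca / gap < ρ := by linarith
    rw [div_lt_iff₀ hgap0] at h1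
    nlinarith [mul_nonneg hC0 hCa0]
  have hdist_aux : 4 * (Cb + C * Ca) / ρ ≤ δ / 2 := by
    rw [div_le_iff₀ hρ0]
    have h1 : 8 * (Cb + C * Ca) / δ < ρ := by linarith
    rw [div_lt_iff₀ hδ] at h1
    nlinarith [mul_nonneg hC0 hCa0]
  clear_value ρ
  -- ### the truncated potential and its curl
  set χ : EuclideanSpace ℝ (Fin 3) → ℝ := Literature.Analysis.FluidPDE.cutoff ρ with hχ
  have hχs : ContDiff ℝ ∞ χ := Literature.Analysis.FluidPDE.contDiff_cutoff (n := ⊤) ρ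
  have hχ1 : ∀ x, ‖x‖ ≤ ρ → χ x = 1 := fun x hx => Literature.Analysis.FluidPDE.cutoff_eq_one hρ0 hx
  have hχ0 : ∀ x, 2 * ρ ≤ ‖x‖ → χ x = 0 := fun x hx => Literature.Analysis.FluidPDE.cutoff_eq_zero hρ0 hx
  have hχle : ∀ x, |χ x| ≤ 1 := fun x => Literature.Analysis.FluidPDE.abs_cutoff_le_one ρ x
  have hDχ : ∀ x, ‖fderiv ℝ χ x‖ ≤ C / ρ := fun x => hC ρ hρ0 x
  set B : EuclideanSpace ℝ (Fin 3) → EuclideanSpace ℝ (Fin 3) := fun x => χ x • A x with hB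
  have hBs : ContDiff ℝ ∞ B := hχs.smul hA
  have hAd : ∀ x, DifferentiableAt ℝ A x := fun x => (hA.differentiable (by simp)) x
  have hχd : ∀ x, DifferentiableAt ℝ χ x := fun x => (hχs.differentiable (by simp)) x
  have hBd : ∀ x, DifferentiableAt ℝ B x := fun x => (hBs.differentiable (by simp)) x
  -- `‖DB(x)‖ ≤ |χ| ‖DA‖ + ‖Dχ‖ ‖A‖`
  have hDB : ∀ x, ‖fderiv ℝ B x‖ ≤ |χ x| * ‖fderiv ℝ A x‖ + ‖fderiv ℝ χ x‖ * ‖A x‖ := by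
    intro x
    rw [hB, fderiv_fun_smul (hχd x) (hAd x)]
    refine (norm_add_le _ _).trans (add_le_add ?_ ?_)
    · rw [norm_smul, Real.norm_eq_abs]
    · rw [ContinuousLinearMap.norm_smulRight_apply]
  refine ⟨curl B, 2 * ρ, contDiff_curl_top hBs, isDivFree_curl hBs, ?_, ?_, by linarith, ?_⟩
  · -- support
    refine tsupport_curl_subset (closure_minimal (fun x hx => ?_) isClosed_closedBall)
    rw [mem_closedBall_zero_iff]
    by_contra h
    exact hx (by rw [hB]; simp [hχ0 x (le_of_lt (not_le.1 h))])
  · -- speed `< Y₀`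
    intro x
    have h1 := norm_curl_le_four_mul B x
    have h2 := hDB x
    have h3 : |χ x| * ‖fderiv ℝ A x‖ ≤ L := by
      calc |χ x| * ‖fderiv ℝ A x‖ ≤ 1 * L := mul_le_mul (hχle x) (hL x) (norm_nonneg _) zero_le_one
        _ = L := one_mul _
    have h4 : ‖fderiv ℝ χ x‖ * ‖A x‖ ≤ C / ρ * Ca :=
      mul_le_mul (hDχ x) (hAsup x) (norm_nonneg _) (div_nonneg hC0 hρ0.le)
    have h5 : C / ρ * Ca = C * Ca / ρ := by ring
    rw [h5] at h4
    have : 4 * (L + gap) = TowerRates.wide.Y 0 := by rw [hgap]; ring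
    linarith
  · -- sup distance
    intro x
    have hsub : curl B x - curl A x = curl (fun y => B y - A y) x := (curl_sub (hBd x) (hAd x)).symm
    have hfun : (fun y => B y - A y) = fun y => (χ y - 1) • A y := by
      funext y; rw [hB]; simp [sub_smul]
    rw [hsub, hfun]
    have hχ1d : ∀ y, DifferentiableAt ℝ (fun y => χ y - 1) y := fun y => (hχd y).sub_const 1
    have h1 := norm_curl_le_four_mul (fun y => (χ y - 1) • A y) x
    have h2 : ‖fderiv ℝ (fun y => (χ y - 1) • A y) x‖ ≤
        |χ x - 1| * ‖fderiv ℝ A x‖ + ‖fderiv ℝ χ x‖ * ‖A x‖ := by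
      rw [fderiv_fun_smul (hχ1d x) (hAd x), fderiv_sub_const]
      refine (norm_add_le _ _).trans (add_le_add ?_ ?_)
      · rw [norm_smul, Real.norm_eq_abs]
      · rw [ContinuousLinearMap.norm_smulRight_apply]
    have h4 : ‖fderiv ℝ χ x‖ * ‖A x‖ ≤ C * Ca / ρ := by
      have := mul_le_mul (hDχ x) (hAsup x) (norm_nonneg _) (div_nonneg hC0 hρ0.le)
      calc ‖fderiv ℝ χ x‖ * ‖A x‖ ≤ C / ρ * Ca := this
        _ = C * Ca / ρ := by ring
    -- the first term: zero inside the ball, `≤ Cb/ρ` outside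
    have h3 : |χ x - 1| * ‖fderiv ℝ A x‖ ≤ Cb / ρ := by
      by_cases hx : ‖x‖ ≤ ρ
      · rw [hχ1 x hx, sub_self, abs_zero, zero_mul]; positivity
      · rw [not_le] at hx
        have ha : |χ x - 1| ≤ 1 := by
          have := hχle x
          have h0 : 0 ≤ χ x := Literature.Analysis.FluidPDE.cutoff_nonneg ρ x
          have h1' : χ x ≤ 1 := Literature.Analysis.FluidPDE.cutoff_le_one ρ x
          rw [abs_le]; constructor <;> linarith
        have hb : ‖fderiv ℝ A x‖ ≤ Cb / ρ := by
          refine (hA1 x).trans ?_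
          exact div_le_div_of_nonneg_left hCb0 hρ0 (by linarith)
        calc |χ x - 1| * ‖fderiv ℝ A x‖ ≤ 1 * (Cb / ρ) := mul_le_mul ha hb (norm_nonneg _) zero_le_one
          _ = Cb / ρ := one_mul _
    have h6 : 4 * (Cb / ρ + C * Ca / ρ) = 4 * (Cb + C * Ca) / ρ := by ring
    linarith

/-! ## Appendix (ecbridge-3 g9): the truncation with an ARBITRARY speed bound `Y` (for the doors at arbitrary rates `R`,
where the bound is `Y₀(R)`; the proof is the one above verbatim with `Y` in place of `Y₀`) -/

/-- **Compactly supported approximants of `curl A` by truncating the potential, any speed bound.** Let `A` be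
smooth and Schwartz with `‖DA(x)‖ ≤ L` for all `x` and `4L < Y`. Then for every `R` and every `δ > 0` there
are `W'`, `R'` with `W'` smooth, divergence free, `tsupport W' ⊆ B̄(0, R')`, `‖W'‖ < Y`, `R ≤ R'` and
`‖W'(x) − curl A(x)‖ ≤ δ` for all `x` (`W' = curl (cutoff ρ • A)`, `R' = 2ρ`, `ρ` large). At `Y = Y₀(wide)`
this is `exists_compact_truncation_curl`. [cite: MajdaBertozziCUP2002, §1.1 (1.11)] -/
theorem exists_compact_truncation_curl_of_lt (hA : ContDiff ℝ ∞ A) (hAdec : HasRapidSpatialDecay A)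
    (hL : ∀ x, ‖fderiv ℝ A x‖ ≤ L) {Y : ℝ} (h4L : 4 * L < Y) (R : ℝ) {δ : ℝ} (hδ : 0 < δ) :
    ∃ (W' : EuclideanSpace ℝ (Fin 3) → EuclideanSpace ℝ (Fin 3)) (R' : ℝ),
      ContDiff ℝ ∞ W' ∧ VectorCalculus.IsDivFree W' ∧ tsupport W' ⊆ closedBall 0 R' ∧
      (∀ x, ‖W' x‖ < Y) ∧ R ≤ R' ∧ ∀ x, ‖W' x - curl A x‖ ≤ δ := by
  -- ### decay constants of `A` and `DA`, the cut-off gradient constant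
  obtain ⟨Ca, hCa⟩ := hAdec 0 1
  obtain ⟨Cb, hCb⟩ := hAdec 1 1
  have hA0 : ∀ x, ‖A x‖ ≤ Ca / (1 + ‖x‖) := fun x => by
    have h := hCa x
    rw [pow_one, norm_iteratedFDeriv_zero] at h
    rw [le_div_iff₀ (by positivity)]; linarith
  have hA1 : ∀ x, ‖fderiv ℝ A x‖ ≤ Cb / (1 + ‖x‖) := fun x => by
    have h := hCb x
    rw [pow_one, ← norm_iteratedFDeriv_fderiv, norm_iteratedFDeriv_zero] at h
    rw [le_div_iff₀ (by positivity)]; linarith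
  have hCa0 : 0 ≤ Ca := by
    have := hA0 0; have h2 := norm_nonneg (A 0)
    have : (0 : ℝ) ≤ Ca / (1 + ‖(0 : EuclideanSpace ℝ (Fin 3))‖) := h2.trans this
    simpa using this
  have hCb0 : 0 ≤ Cb := by
    have := hA1 0; have h2 := norm_nonneg (fderiv ℝ A 0)
    have : (0 : ℝ) ≤ Cb / (1 + ‖(0 : EuclideanSpace ℝ (Fin 3))‖) := h2.trans this
    simpa using this
  have hAsup : ∀ x, ‖A x‖ ≤ Ca := fun x =>
    (hA0 x).trans (div_le_self hCa0 (by linarith [norm_nonneg x]))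
  have hL0 : 0 ≤ L := (norm_nonneg _).trans (hL 0)
  obtain ⟨C, hC0, hC⟩ := Literature.Analysis.FluidPDE.exists_norm_fderiv_cutoff_le (E := EuclideanSpace ℝ (Fin 3))
  -- ### the radius
  set gap : ℝ := Y / 4 - L with hgap
  have hgap0 : 0 < gap := by rw [hgap]; linarith
  set ρ : ℝ := max (max R 1) (max (2 * C * Ca / gap + 1) (8 * (Cb + C * Ca) / δ + 1)) with hρ_def
  have hρ1 : 1 ≤ ρ := (le_max_right _ _).trans (le_max_left _ _)
  have hρ0 : 0 < ρ := by linarith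
  have hρR : R ≤ ρ := (le_max_left _ _).trans (le_max_left _ _)
  have hρgap : 2 * C * Ca / gap + 1 ≤ ρ := (le_max_left _ _).trans (le_max_right _ _)
  have hρδ : 8 * (Cb + C * Ca) / δ + 1 ≤ ρ := (le_max_right _ _).trans (le_max_right _ _)
  have hspeed_aux : C * Ca / ρ < gap := by
    rw [div_lt_iff₀ hρ0]
    have h1 : 2 * C * Ca / gap < ρ := by linarith
    rw [div_lt_iff₀ hgap0] at h1
    nlinarith [mul_nonneg hC0 hCa0]
  have hdist_aux : 4 * (Cb + C * Ca) / ρ ≤ δ / 2 := by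
    rw [div_le_iff₀ hρ0]
    have h1 : 8 * (Cb + C * Ca) / δ < ρ := by linarith
    rw [div_lt_iff₀ hδ] at h1
    nlinarith [mul_nonneg hC0 hCa0]
  clear_value ρ
  -- ### the truncated potential and its curl
  set χ : EuclideanSpace ℝ (Fin 3) → ℝ := Literature.Analysis.FluidPDE.cutoff ρ with hχ
  have hχs : ContDiff ℝ ∞ χ := Literature.Analysis.FluidPDE.contDiff_cutoff (n := ⊤) ρ
  have hχ1 : ∀ x, ‖x‖ ≤ ρ → χ x = 1 := fun x hx => Literature.Analysis.FluidPDE.cutoff_eq_one hρ0 hx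
  have hχ0 : ∀ x, 2 * ρ ≤ ‖x‖ → χ x = 0 := fun x hx => Literature.Analysis.FluidPDE.cutoff_eq_zero hρ0 hx
  have hχle : ∀ x, |χ x| ≤ 1 := fun x => Literature.Analysis.FluidPDE.abs_cutoff_le_one ρ x
  have hDχ : ∀ x, ‖fderiv ℝ χ x‖ ≤ C / ρ := fun x => hC ρ hρ0 x
  set B : EuclideanSpace ℝ (Fin 3) → EuclideanSpace ℝ (Fin 3) := fun x => χ x • A x with hB
  have hBs : ContDiff ℝ ∞ B := hχs.smul hA
  have hAd : ∀ x, DifferentiableAt ℝ A x := fun x => (hA.differentiable (by simp)) x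
  have hχd : ∀ x, DifferentiableAt ℝ χ x := fun x => (hχs.differentiable (by simp)) x
  have hBd : ∀ x, DifferentiableAt ℝ B x := fun x => (hBs.differentiable (by simp)) x
  have hDB : ∀ x, ‖fderiv ℝ B x‖ ≤ |χ x| * ‖fderiv ℝ A x‖ + ‖fderiv ℝ χ x‖ * ‖A x‖ := by
    intro x
    rw [hB, fderiv_fun_smul (hχd x) (hAd x)]
    refine (norm_add_le _ _).trans (add_le_add ?_ ?_)
    · rw [norm_smul, Real.norm_eq_abs]
    · rw [ContinuousLinearMap.norm_smulRight_apply]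
  refine ⟨curl B, 2 * ρ, contDiff_curl_top hBs, isDivFree_curl hBs, ?_, ?_, by linarith, ?_⟩
  · -- support
    refine tsupport_curl_subset (closure_minimal (fun x hx => ?_) isClosed_closedBall)
    rw [mem_closedBall_zero_iff]
    by_contra h
    exact hx (by rw [hB]; simp [hχ0 x (le_of_lt (not_le.1 h))])
  · -- speed `< Y`
    intro x
    have h1 := norm_curl_le_four_mul B x
    have h2 := hDB x
    have h3 : |χ x| * ‖fderiv ℝ A x‖ ≤ L := by
      calc |χ x| * ‖fderiv ℝ A x‖ ≤ 1 * L := mul_le_mul (hχle x) (hL x) (norm_nonneg _) zero_le_one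
        _ = L := one_mul _
    have h4 : ‖fderiv ℝ χ x‖ * ‖A x‖ ≤ C / ρ * Ca :=
      mul_le_mul (hDχ x) (hAsup x) (norm_nonneg _) (div_nonneg hC0 hρ0.le)
    have h5 : C / ρ * Ca = C * Ca / ρ := by ring
    rw [h5] at h4
    have : 4 * (L + gap) = Y := by rw [hgap]; ring
    linarith
  · -- sup distance
    intro x
    have hsub : curl B x - curl A x = curl (fun y => B y - A y) x := (curl_sub (hBd x) (hAd x)).symm
    have hfun : (fun y => B y - A y) = fun y => (χ y - 1) • A y := by
      funext y; rw [hB]; simp [sub_smul]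
    rw [hsub, hfun]
    have hχ1d : ∀ y, DifferentiableAt ℝ (fun y => χ y - 1) y := fun y => (hχd y).sub_const 1
    have h1 := norm_curl_le_four_mul (fun y => (χ y - 1) • A y) x
    have h2 : ‖fderiv ℝ (fun y => (χ y - 1) • A y) x‖ ≤
        |χ x - 1| * ‖fderiv ℝ A x‖ + ‖fderiv ℝ χ x‖ * ‖A x‖ := by
      rw [fderiv_fun_smul (hχ1d x) (hAd x), fderiv_sub_const]
      refine (norm_add_le _ _).trans (add_le_add ?_ ?_)
      · rw [norm_smul, Real.norm_eq_abs]
      · rw [ContinuousLinearMap.norm_smulRight_apply]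
    have h4 : ‖fderiv ℝ χ x‖ * ‖A x‖ ≤ C * Ca / ρ := by
      have := mul_le_mul (hDχ x) (hAsup x) (norm_nonneg _) (div_nonneg hC0 hρ0.le)
      calc ‖fderiv ℝ χ x‖ * ‖A x‖ ≤ C / ρ * Ca := this
        _ = C * Ca / ρ := by ring
    have h3 : |χ x - 1| * ‖fderiv ℝ A x‖ ≤ Cb / ρ := by
      by_cases hx : ‖x‖ ≤ ρ
      · rw [hχ1 x hx, sub_self, abs_zero, zero_mul]; positivity
      · rw [not_le] at hx
        have ha : |χ x - 1| ≤ 1 := by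
          have := hχle x
          have h0 : 0 ≤ χ x := Literature.Analysis.FluidPDE.cutoff_nonneg ρ x
          have h1' : χ x ≤ 1 := Literature.Analysis.FluidPDE.cutoff_le_one ρ x
          rw [abs_le]; constructor <;> linarith
        have hb : ‖fderiv ℝ A x‖ ≤ Cb / ρ := by
          refine (hA1 x).trans ?_
          exact div_le_div_of_nonneg_left hCb0 hρ0 (by linarith)
        calc |χ x - 1| * ‖fderiv ℝ A x‖ ≤ 1 * (Cb / ρ) := mul_le_mul ha hb (norm_nonneg _) zero_le_one
          _ = Cb / ρ := one_mul _
    have h6 : 4 * (Cb / ρ + C * Ca / ρ) = 4 * (Cb + C * Ca) / ρ := by ring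
    linarith

end Summit.NavierStokesRegularity.FluidComputer.PalasekTowerClayBridge.Germ

end
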